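import Literature.AnabelianGeometry.SemiGraphs.PSCTwoComponentAffineShapeEdges
import Literature.AnabelianGeometry.SemiGraphs.PSCMultiVertexCriteria
import Literature.AnabelianGeometry.SemiGraphs.PSCEdgeLikeIncidenceCriteria
import Literature.AnabelianGeometry.SemiGraphs.ProSigmaCuspInertiaMalnormalHolds
import Literature.AnabelianGeometry.SemiGraphs.ProSigmaCuspInertia
import Literature.GroupTheory.CombinatorialGroupTheory.PuncturedSurfaceGroupTwoComponentBases
import HarnessLib

/-!
# [CombGC] Prop. 1.2 (ii) and Prop. 1.5 (i) at GENUINE TWO-COMPONENT AFFINE data, via free factors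

Mochizuki, *A combinatorial version of the Grothendieck conjecture* [CombGC] §1, Prop. 1.2 (ii) p. 8
("verticial and edge-like subgroups are commensurably terminal") and Prop. 1.5 (i) p. 12 ("an edge-like
subgroup is cuspidal (resp. not cuspidal) iff it is contained in precisely one (resp. precisely two)
verticial subgroup(s)") [cite: MochizukiCombGC2007, Prop 1.2(ii) p.8] [cite: MochizukiCombGC2007, Prop 1.5(i) p.12].
PROOF-ONLY file (abc-iut-f-164 gen 3; abc-iut FACT-LIST rows F-0438 `PSCDatum.CommensurableTerminalityHolds`
and F-0440 `PSCDatum.EdgeLikeIncidenceHolds` — schemata over the origin parameter `Ω : PSCOrigin`, universal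
closures refuted, instance forms the content).  Previously these two rows were instance-proved at
multi-vertex data only at the genus-`0` TWO-TRIPOD datum over `Γ̂_{0,4}` (abc-iut-L5-t6,
`PSCTwoTripodOrigin.lean` / `PSCTwoTripodIncidence.lean`).  Here: EVERY datum of the two-component AFFINE
shape of abc-iut-f-164 (`PSCTwoComponentAffineShape.lean`: a pointed stable curve `C₀ ∪_ν C₁`, handles
`i < g₀` and cusps `s ≤ j` on `C₀`, the others on `C₁`, ANY genera, `s ≥ 2`, `r − s ≥ 2`; `Π` any profinite
pro-`Σ` completion `ι : Γ_{g,r} → Π`, any `Σ`; `Π_{v₀} = cl ι⟨a_i, b_i (i<g₀), c_j (j≥s)⟩`,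
`Π_{v₁} = cl ι⟨a_i, b_i (i≥g₀), c_j (j<s), ε⟩`, `Π_ν = cl ι⟨ε⟩`, `ε = (c_s⋯c_{r−1})∏_{i<g₀}[a_i,b_i]`).

## Mechanism: ONE free basis carries the two vertices and the node

In abc-iut-f-166's node-loop basis `b' = (a_i, b_i, c_1, …, c_{s−1}, ε, c_{s+1}, …, c_{r−1})` of `Γ_{g,r}`
(`PuncturedSurfaceGroupNodeLoopBasis.lean`) BOTH subsurface groups are sub-basis closures
(`PuncturedSurfaceGroupTwoComponentBases.lean`): `Π_{v₀} = A_{S₀}`, `Π_{v₁} = A_{T₁}`, `Π_ν = A_{{ε}}` with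
`S₀ ∩ T₁ = {ε}`.  Hence, by abc-iut-L5-t6's free-factor series (Ribes–Zalesskii 9.1.12 along a pro-`Σ`
completion; `ProSigmaFreeFactor{Malnormal,Disjoint}.lean`): `Π_{v₀} ∩ Π_{v₁} = Π_ν` (`freeFactor_inf_eq`),
all three are commensurably terminal and malnormal, and every cusp `c_j`, `j ∉ {0, s}`, is a member of `b'`
OUTSIDE `S₀` resp. `T₁`, so its closed inertia group meets every conjugate of the other component's group
trivially (`freeFactor_inf_conj_eq_bot_of_disjoint`); the two remaining cusps `c_s`, `c_0` become such
members after ONE Nielsen move each (`exists_freeGroupBasis_nodeLoop_cusp{,_zero}`).  Cusp groups are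
commensurably terminal and infinite by the cusp-inertia theorems (`cuspInertia_closure_isCommensurablyTerminal`,
`infinite_cuspInertia_closure`).  Feeding abc-iut-L5-t6's criteria `verticialEdgeLikeCommensurablyTerminal_of` /
`edgeLikeIncidence_of`:

* `twoComponentAffine_freeFactor_rows` — at every such datum: `VerticialEdgeLikeCommensurablyTerminal`
  (Prop. 1.2 (ii), first clause) ∧ `EdgeLikeIncidence` (Prop. 1.5 (i)) ∧ `Π_{v₀} ⊓ Π_{v₁} = Π_ν` ∧
  `Π_{v₀} ≠ Π_{v₁}`; projections `verticialEdgeLikeCommensurablyTerminal_of_twoComponentAffine`,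
  `edgeLikeIncidence_of_twoComponentAffine`, and the distinct-branch-overgroups link
  `branchLink_of_twoComponentAffine` (input of abc-iut-w4-d081's Prop. 1.5 (ii) reduction).

Honest scope: the STURDY `Π^unr`-clause of Prop. 1.2 (ii) (`UnrVerticialCommensurablyTerminal`, both genera
`≥ 2`) is NOT treated (it needs commensurable terminality in the free pro-`Σ` PRODUCT `Π^unr`); a shape
instance is consistency evidence for the typed schemata, not the printed theorems for all pointed stable
curves (cell FOUNDATIONS rows 13–14).  0 definitions; nothing here takes a side on [IUTchIII] Cor. 3.12.
-/

noncomputable section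

namespace Literature.AnabelianGeometry.SemiGraphs

namespace PSCDatum

open scoped Pointwise
open Literature.GroupTheory.CombinatorialGroupTheory
open Literature.GroupTheory.CombinatorialGroupTheory.PuncturedSurfaceGroup (a b c cuspInertia
  exists_freeGroupBasis_nodeLoop closure_firstSubsurface_eq_nodeLoopBasis
  closure_secondSubsurface_eq_nodeLoopBasis exists_freeGroupBasis_nodeLoop_cusp
  exists_freeGroupBasis_nodeLoop_cusp_zero)
open SemiGraphOfAnabelioids (IsProSigmaCompletion infinite_cuspInertia_closure
  cuspInertia_closure_isCommensurablyTerminal)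
open SemiGraphOfAnabelioids.IsProSigmaCompletion (freeFactor_inf_conj_eq_bot_of_disjoint freeFactor_inf_eq
  infinite_freeFactor freeFactor_isCommensurablyTerminal mem_freeFactor_of_inf_conj_ne_bot)

universe u

variable {P : Type u} [Group P] [TopologicalSpace P] [IsTopologicalGroup P]
variable [CompactSpace P] [T2Space P] [TotallyDisconnectedSpace P] {Sigma : Set ℕ} {g r : ℕ}

omit [TopologicalSpace P] [IsTopologicalGroup P] [CompactSpace P] [T2Space P]
  [TotallyDisconnectedSpace P] in
/-- An infinite subgroup is not trivial. [cite: MochizukiCombGC2007, Rmk 1.1.3 p.7] -/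
private theorem ne_bot_of_infinite₂ {H : Subgroup P} (h : Infinite H) : H ≠ ⊥ := by
  rintro rfl
  exact h.not_finite inferInstance

omit [CompactSpace P] [T2Space P] [TotallyDisconnectedSpace P] in
/-- A cyclic subgroup generated inside a set of generators has its closed image inside the closed image
of the generated subgroup. [cite: MochizukiCombGC2007, Def 1.1(ii) p.6] -/
private theorem zpowers_closure_le {Γ : Type*} [Group Γ] (ι : Γ →* P) {x : Γ} {S : Set Γ}
    (hx : x ∈ Subgroup.closure S) :
    ((Subgroup.zpowers x).map ι).topologicalClosure ≤ ((Subgroup.closure S).map ι).topologicalClosure :=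
  Subgroup.topologicalClosure_mono (Subgroup.map_mono ((Subgroup.zpowers_le (g := x)).mpr hx))

/-- **[CombGC] Prop. 1.2 (ii) (verticial/edge-like clause) and Prop. 1.5 (i) at every datum of two-component
affine shape, with `Π_{v₀} ∩ Π_{v₁} = Π_ν` and `Π_{v₀} ≠ Π_{v₁}`** — all four from ONE free basis of
`Γ_{g,r}` carrying `Π_{v₀}`, `Π_{v₁}`, `Π_ν` as sub-basis closures (module docstring).
[cite: MochizukiCombGC2007, Prop 1.2(ii) p.8] [cite: MochizukiCombGC2007, Prop 1.5(i) p.12] -/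
theorem twoComponentAffine_freeFactor_rows (hne : Sigma.Nonempty)
    (hprime : ∀ p ∈ Sigma, p.Prime) (ι : PuncturedSurfaceGroup g r →* P)
    (hι : IsProSigmaCompletion Sigma ι) (G : PSCDatum P) {g₀ s : ℕ} (hs : 2 ≤ s) (hsr : s + 2 ≤ r)
    (e : G.graph.C ≃ Fin r)
    (hC : ∀ c, G.cuspGp c =
      ((PuncturedSurfaceGroup.cuspInertia (g := g) (e c)).map ι).topologicalClosure)
    (v₀ v₁ : G.graph.V) (hV : ∀ w, w = v₀ ∨ w = v₁) (ε : PuncturedSurfaceGroup g r)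
    (hε : ε = ((List.finRange r).map fun j : Fin r =>
          if s ≤ (j : ℕ) then PuncturedSurfaceGroup.c (g := g) j else 1).prod *
        ((List.finRange g).map fun i : Fin g => if (i : ℕ) < g₀ then
          PuncturedSurfaceGroup.a (r := r) i * PuncturedSurfaceGroup.b i *
            (PuncturedSurfaceGroup.a i)⁻¹ * (PuncturedSurfaceGroup.b i)⁻¹ else 1).prod)
    (hV₀ : G.vertGp v₀ = ((Subgroup.closure {x : PuncturedSurfaceGroup g r |
        (∃ i : Fin g, (i : ℕ) < g₀ ∧ (x = PuncturedSurfaceGroup.a i ∨ x = PuncturedSurfaceGroup.b i)) ∨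
        ∃ j : Fin r, s ≤ (j : ℕ) ∧ x = PuncturedSurfaceGroup.c j}).map ι).topologicalClosure)
    (hV₁ : G.vertGp v₁ = ((Subgroup.closure {x : PuncturedSurfaceGroup g r |
        (∃ i : Fin g, g₀ ≤ (i : ℕ) ∧ (x = PuncturedSurfaceGroup.a i ∨ x = PuncturedSurfaceGroup.b i)) ∨
        (∃ j : Fin r, (j : ℕ) < s ∧ x = PuncturedSurfaceGroup.c j) ∨ x = ε}).map ι).topologicalClosure)
    (n₀ : G.graph.N) (hN : ∀ n, n = n₀)
    (hE : G.nodeGp n₀ = ((Subgroup.zpowers ε).map ι).topologicalClosure) :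
    G.VerticialEdgeLikeCommensurablyTerminal ∧ G.EdgeLikeIncidence ∧
      G.vertGp v₀ ⊓ G.vertGp v₁ = G.nodeGp n₀ ∧ G.vertGp v₀ ≠ G.vertGp v₁ := by
  classical
  obtain ⟨r', rfl⟩ : ∃ r', r = r' + 1 := ⟨r - 1, by omega⟩
  have hp : ∃ p ∈ Sigma, p.Prime := by
    obtain ⟨p, hp⟩ := hne
    exact ⟨p, hp, hprime p hp⟩
  have hhyp : PuncturedSurfaceGroup.IsHyperbolicType g (r' + 1) := by
    unfold PuncturedSurfaceGroup.IsHyperbolicType; omega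
  have hs1' : s - 1 < r' := by omega
  have hs' : s < r' := by omega
  have hr0 : 0 < r' := by omega
  have hsr₁ : s < r' + 1 := by omega
  have hr0₁ : 0 < r' + 1 := by omega
  -- the node-loop basis and the two Nielsen variants
  obtain ⟨b', ha', hb', hc', hk'⟩ := exists_freeGroupBasis_nodeLoop g r' g₀ s (by omega) (by omega) ε hε
  have hk : ∀ h : s - 1 < r', b' (Sum.inr ⟨s - 1, h⟩) = ε := fun _ => hk'
  obtain ⟨b₄, hb₄τ, hb₄⟩ :=
    exists_freeGroupBasis_nodeLoop_cusp hε ha' hb' hc' hk (by omega) (by omega)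
  obtain ⟨b₅, hb₅κ, hb₅⟩ :=
    exists_freeGroupBasis_nodeLoop_cusp_zero hε ha' hb' hc' hk hs (by omega)
  -- index sets and the three special slots
  set S₀ : Set ((Fin g × Bool) ⊕ Fin r') :=
    {x | Sum.elim (fun p : Fin g × Bool => (p.1 : ℕ) < g₀) (fun j : Fin r' => s ≤ (j : ℕ) + 1) x} with hS₀
  set T₁ : Set ((Fin g × Bool) ⊕ Fin r') :=
    {x | Sum.elim (fun p : Fin g × Bool => g₀ ≤ (p.1 : ℕ)) (fun j : Fin r' => (j : ℕ) + 1 ≤ s) x} with hT₁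
  have hSl : ∀ p : Fin g × Bool, (Sum.inl p : (Fin g × Bool) ⊕ Fin r') ∈ S₀ ↔ (p.1 : ℕ) < g₀ :=
    fun _ => Iff.rfl
  have hSr : ∀ j : Fin r', (Sum.inr j : (Fin g × Bool) ⊕ Fin r') ∈ S₀ ↔ s ≤ (j : ℕ) + 1 := fun _ => Iff.rfl
  have hTl : ∀ p : Fin g × Bool, (Sum.inl p : (Fin g × Bool) ⊕ Fin r') ∈ T₁ ↔ g₀ ≤ (p.1 : ℕ) :=
    fun _ => Iff.rfl
  have hTr : ∀ j : Fin r', (Sum.inr j : (Fin g × Bool) ⊕ Fin r') ∈ T₁ ↔ (j : ℕ) + 1 ≤ s := fun _ => Iff.rfl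
  set σ : (Fin g × Bool) ⊕ Fin r' := Sum.inr ⟨s - 1, hs1'⟩ with hσ
  set τ : (Fin g × Bool) ⊕ Fin r' := Sum.inr ⟨s, hs'⟩ with hτ
  set κ : (Fin g × Bool) ⊕ Fin r' := Sum.inr ⟨0, hr0⟩ with hκ
  have hσS : σ ∈ S₀ := (hSr _).mpr (by simp only; omega)
  have hσT : σ ∈ T₁ := (hTr _).mpr (by simp only; omega)
  have hτS : τ ∈ S₀ := (hSr _).mpr (by simp only; omega)
  have hτT : τ ∉ T₁ := fun h => by have := (hTr _).mp h; simp only at this; omega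
  have hκS : κ ∉ S₀ := fun h => by have := (hSr _).mp h; simp only at this; omega
  have hστ : σ ≠ τ := by simp only [hσ, hτ, Ne, Sum.inr.injEq, Fin.mk.injEq]; omega
  have hσκ : σ ≠ κ := by simp only [hσ, hκ, Ne, Sum.inr.injEq, Fin.mk.injEq]; omega
  have hST : S₀ ∩ T₁ = {σ} := by
    ext x
    constructor
    · rintro ⟨h0, h1⟩
      rcases x with ⟨i, bb⟩ | j
      · exact absurd (lt_of_lt_of_le ((hSl _).mp h0) ((hTl _).mp h1)) (lt_irrefl _)
      · have h0' := (hSr _).mp h0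
        have h1' := (hTr _).mp h1
        rw [Set.mem_singleton_iff, hσ]
        exact congrArg Sum.inr (Fin.ext (by simp only; omega))
    · rintro rfl
      exact ⟨hσS, hσT⟩
  -- the three non-cuspidal representatives as sub-basis closures of `b'`
  have hA₀ : G.vertGp v₀ = ((Subgroup.closure (b' '' S₀)).map ι).topologicalClosure := by
    rw [hV₀, closure_firstSubsurface_eq_nodeLoopBasis hε ha' hb' hc' hk (by omega) (by omega)]
  have hA₁ : G.vertGp v₁ = ((Subgroup.closure (b' '' T₁)).map ι).topologicalClosure := by
    rw [hV₁, closure_secondSubsurface_eq_nodeLoopBasis hε ha' hb' hc' hk (by omega) (by omega)]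
  have hN₀ : G.nodeGp n₀ = ((Subgroup.closure (b' '' {σ})).map ι).topologicalClosure := by
    rw [hE, closure_image_singleton, hσ, hk hs1']
  -- cusp groups as singleton sub-basis closures (three bases)
  have hK : ∀ j : Fin (r' + 1), ((PuncturedSurfaceGroup.cuspInertia (g := g) j).map ι).topologicalClosure =
      ((Subgroup.zpowers (c (g := g) j)).map ι).topologicalClosure := fun _ => rfl
  have hKb' : ∀ (j : Fin (r' + 1)) (hj0 : (j : ℕ) ≠ 0), (j : ℕ) ≠ s →
      Subgroup.zpowers (c (g := g) j) =
        Subgroup.closure (b' '' {Sum.inr (j.pred (fun h => hj0 (by rw [h]; rfl)))}) := by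
    intro j hj0 hjs
    rw [closure_image_singleton, hc' _ (by rw [Fin.val_pred]; omega), Fin.succ_pred]
  have hKτ : Subgroup.zpowers (c (g := g) ⟨s, hsr₁⟩) = Subgroup.closure (b₄ '' {τ}) := by
    rw [closure_image_singleton, hτ, hb₄τ]
  have hKκ : Subgroup.zpowers (c (g := g) ⟨0, hr0₁⟩) = Subgroup.closure (b₅ '' {κ}) := by
    rw [closure_image_singleton, hκ, hb₅κ]
  -- the sub-basis closures are unchanged under the two Nielsen moves
  have hT₁b₄ : Subgroup.closure (b' '' T₁) = Subgroup.closure (b₄ '' T₁) :=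
    closure_image_congr fun x hx => (hb₄ x (fun h => hτT (h ▸ hx))).symm
  have hσb₄ : Subgroup.closure (b' '' {σ}) = Subgroup.closure (b₄ '' {σ}) :=
    closure_image_congr fun x hx => (hb₄ x (fun h => hστ ((Set.mem_singleton_iff.mp hx).symm.trans h))).symm
  have hS₀b₅ : Subgroup.closure (b' '' S₀) = Subgroup.closure (b₅ '' S₀) :=
    closure_image_congr fun x hx => (hb₅ x (fun h => hκS (h ▸ hx))).symm
  have hσb₅ : Subgroup.closure (b' '' {σ}) = Subgroup.closure (b₅ '' {σ}) :=
    closure_image_congr fun x hx => (hb₅ x (fun h => hσκ ((Set.mem_singleton_iff.mp hx).symm.trans h))).symm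
  -- (a) `Π_{v₀} ∩ Π_{v₁} = Π_ν`
  have hinf : G.vertGp v₀ ⊓ G.vertGp v₁ = G.nodeGp n₀ := by
    rw [hA₀, hA₁, hN₀, freeFactor_inf_eq b' S₀ T₁ hι, hST]
  -- (b) `Π_{v₀} ≠ Π_{v₁}`: the member `c_{s+1}` of `S₀` meets `Π_{v₁}` trivially
  have hvne : G.vertGp v₀ ≠ G.vertGp v₁ := by
    intro h
    have h0 := freeFactor_inf_conj_eq_bot_of_disjoint b' {τ} T₁ (Set.disjoint_singleton_left.mpr hτT) hι 1
    rw [map_one, one_smul] at h0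
    have hle : ((Subgroup.closure (b' '' {τ})).map ι).topologicalClosure ≤
        ((Subgroup.closure (b' '' T₁)).map ι).topologicalClosure := by
      rw [← hA₁, ← h, hA₀]
      exact Subgroup.topologicalClosure_mono (Subgroup.map_mono (Subgroup.closure_mono
        (Set.image_mono (Set.singleton_subset_iff.mpr hτS))))
    exact ne_bot_of_infinite₂ (infinite_freeFactor b' {τ} ⟨τ, rfl⟩ hι hp)
      (le_bot_iff.mp (h0 ▸ le_inf le_rfl hle))
  -- (c) node vs cusps: everywhere-disjoint conjugates
  have hNC : ∀ (j : Fin (r' + 1)) (x : P),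
      ((Subgroup.closure (b' '' {σ})).map ι).topologicalClosure ⊓ ConjAct.toConjAct x •
        ((PuncturedSurfaceGroup.cuspInertia (g := g) j).map ι).topologicalClosure = ⊥ := by
    intro j x
    rw [hK]
    by_cases hj0 : (j : ℕ) = 0
    · have hj : j = ⟨0, hr0₁⟩ := Fin.ext hj0
      rw [hj, hKκ, hσb₅]
      exact freeFactor_inf_conj_eq_bot_of_disjoint b₅ {σ} {κ}
        (Set.disjoint_singleton.mpr hσκ) hι x
    · by_cases hjs : (j : ℕ) = s
      · have hj : j = ⟨s, hsr₁⟩ := Fin.ext hjs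
        rw [hj, hKτ, hσb₄]
        exact freeFactor_inf_conj_eq_bot_of_disjoint b₄ {σ} {τ}
          (Set.disjoint_singleton.mpr hστ) hι x
      · rw [hKb' j hj0 hjs]
        refine freeFactor_inf_conj_eq_bot_of_disjoint b' {σ} _ (Set.disjoint_singleton.mpr ?_) hι x
        rw [hσ, Ne, Sum.inr.injEq, Fin.ext_iff, Fin.val_pred]
        simp only
        omega
  -- (d) cusps of `C₀` vs `Π_{v₁}`, cusps of `C₁` vs `Π_{v₀}`
  have hCV₁ : ∀ (j : Fin (r' + 1)), s ≤ (j : ℕ) → ∀ x : P,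
      ((PuncturedSurfaceGroup.cuspInertia (g := g) j).map ι).topologicalClosure ⊓
        ConjAct.toConjAct x • G.vertGp v₁ = ⊥ := by
    intro j hj x
    rw [hK, hA₁]
    by_cases hjs : (j : ℕ) = s
    · have hj' : j = ⟨s, hsr₁⟩ := Fin.ext hjs
      rw [hj', hKτ, hT₁b₄]
      exact freeFactor_inf_conj_eq_bot_of_disjoint b₄ {τ} T₁ (Set.disjoint_singleton_left.mpr hτT) hι x
    · rw [hKb' j (by omega) hjs]
      refine freeFactor_inf_conj_eq_bot_of_disjoint b' _ T₁ (Set.disjoint_singleton_left.mpr ?_) hι x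
      rw [hTr, Fin.val_pred]
      omega
  have hCV₀ : ∀ (j : Fin (r' + 1)), (j : ℕ) < s → ∀ x : P,
      ((PuncturedSurfaceGroup.cuspInertia (g := g) j).map ι).topologicalClosure ⊓
        ConjAct.toConjAct x • G.vertGp v₀ = ⊥ := by
    intro j hj x
    rw [hK, hA₀]
    by_cases hj0 : (j : ℕ) = 0
    · have hj' : j = ⟨0, hr0₁⟩ := Fin.ext hj0
      rw [hj', hKκ, hS₀b₅]
      exact freeFactor_inf_conj_eq_bot_of_disjoint b₅ {κ} S₀ (Set.disjoint_singleton_left.mpr hκS) hι x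
    · rw [hKb' j hj0 (by omega)]
      refine freeFactor_inf_conj_eq_bot_of_disjoint b' _ S₀ (Set.disjoint_singleton_left.mpr ?_) hι x
      rw [hSr, Fin.val_pred]
      omega
  -- (e) Prop. 1.2 (ii), first clause
  have hct : G.VerticialEdgeLikeCommensurablyTerminal := by
    refine G.verticialEdgeLikeCommensurablyTerminal_of (fun v => ?_) (fun n => ?_) (fun c => ?_)
    · rcases hV v with rfl | rfl
      · rw [hA₀]; exact freeFactor_isCommensurablyTerminal b' _ ⟨σ, hσS⟩ hι hp
      · rw [hA₁]; exact freeFactor_isCommensurablyTerminal b' _ ⟨σ, hσT⟩ hι hp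
    · rw [hN n, hN₀]; exact freeFactor_isCommensurablyTerminal b' _ ⟨σ, rfl⟩ hι hp
    · rw [hC]; exact cuspInertia_closure_isCommensurablyTerminal hne hprime hhyp ι hι (e c)
  -- (f) Prop. 1.5 (i)
  have hinc : G.EdgeLikeIncidence := by
    refine G.edgeLikeIncidence_of (fun v x h => ?_) (fun n => ?_) (fun c => ?_) (fun n c x => ?_)
      (fun n => ⟨v₀, v₁, ?_, ?_, hvne, fun w hw₀ hw₁ x => ?_⟩) (fun c => ?_)
    · -- malnormality of the verticial free factors
      rcases hV v with rfl | rfl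
      · rw [hA₀] at h ⊢; exact mem_freeFactor_of_inf_conj_ne_bot b' _ hι h
      · rw [hA₁] at h ⊢; exact mem_freeFactor_of_inf_conj_ne_bot b' _ hι h
    · rw [hN n, hN₀]; exact ne_bot_of_infinite₂ (infinite_freeFactor b' _ ⟨σ, rfl⟩ hι hp)
    · rw [hC]; exact ne_bot_of_infinite₂ (infinite_cuspInertia_closure hne hprime hhyp ι hι (e c))
    · rw [hN n, hN₀, hC]; exact hNC (e c) x
    · rw [hN n, ← hinf]; exact inf_le_left
    · rw [hN n, ← hinf]; exact inf_le_right
    · rcases hV w with rfl | rfl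
      · exact absurd rfl hw₀
      · exact absurd rfl hw₁
    · -- each cusp: its vertex, and separation from the other vertex group
      rw [hC]
      by_cases hj : s ≤ ((e c : Fin (r' + 1)) : ℕ)
      · refine ⟨v₀, ?_, fun w hw x => ?_⟩
        · rw [hK, hV₀]
          exact zpowers_closure_le ι (Subgroup.subset_closure (Or.inr ⟨e c, hj, rfl⟩))
        · rcases hV w with rfl | rfl
          · exact absurd rfl hw
          · exact hCV₁ (e c) hj x
      · refine ⟨v₁, ?_, fun w hw x => ?_⟩
        · rw [hK, hV₁]
          exact zpowers_closure_le ι (Subgroup.subset_closure (Or.inr (Or.inl ⟨e c, by omega, rfl⟩)))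
        · rcases hV w with rfl | rfl
          · exact hCV₀ (e c) (by omega) x
          · exact absurd rfl hw
  exact ⟨hct, hinc, hinf, hvne⟩

/-! ### The two rows separately, and the branch link -/

/-- **F-0438 / [CombGC] Prop. 1.2 (ii), first clause, at every two-component affine datum**: verticial and
edge-like subgroups are commensurably terminal in `Π_G` (`Π_{v₀}`, `Π_{v₁}`, `Π_ν` as free factors; cusp
inertia). [cite: MochizukiCombGC2007, Prop 1.2(ii) p.8] -/
theorem verticialEdgeLikeCommensurablyTerminal_of_twoComponentAffine (hne : Sigma.Nonempty)
    (hprime : ∀ p ∈ Sigma, p.Prime) (ι : PuncturedSurfaceGroup g r →* P)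
    (hι : IsProSigmaCompletion Sigma ι) (G : PSCDatum P) {g₀ s : ℕ} (hs : 2 ≤ s) (hsr : s + 2 ≤ r)
    (e : G.graph.C ≃ Fin r)
    (hC : ∀ c, G.cuspGp c =
      ((PuncturedSurfaceGroup.cuspInertia (g := g) (e c)).map ι).topologicalClosure)
    (v₀ v₁ : G.graph.V) (hV : ∀ w, w = v₀ ∨ w = v₁) (ε : PuncturedSurfaceGroup g r)
    (hε : ε = ((List.finRange r).map fun j : Fin r =>
          if s ≤ (j : ℕ) then PuncturedSurfaceGroup.c (g := g) j else 1).prod *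
        ((List.finRange g).map fun i : Fin g => if (i : ℕ) < g₀ then
          PuncturedSurfaceGroup.a (r := r) i * PuncturedSurfaceGroup.b i *
            (PuncturedSurfaceGroup.a i)⁻¹ * (PuncturedSurfaceGroup.b i)⁻¹ else 1).prod)
    (hV₀ : G.vertGp v₀ = ((Subgroup.closure {x : PuncturedSurfaceGroup g r |
        (∃ i : Fin g, (i : ℕ) < g₀ ∧ (x = PuncturedSurfaceGroup.a i ∨ x = PuncturedSurfaceGroup.b i)) ∨
        ∃ j : Fin r, s ≤ (j : ℕ) ∧ x = PuncturedSurfaceGroup.c j}).map ι).topologicalClosure)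
    (hV₁ : G.vertGp v₁ = ((Subgroup.closure {x : PuncturedSurfaceGroup g r |
        (∃ i : Fin g, g₀ ≤ (i : ℕ) ∧ (x = PuncturedSurfaceGroup.a i ∨ x = PuncturedSurfaceGroup.b i)) ∨
        (∃ j : Fin r, (j : ℕ) < s ∧ x = PuncturedSurfaceGroup.c j) ∨ x = ε}).map ι).topologicalClosure)
    (n₀ : G.graph.N) (hN : ∀ n, n = n₀)
    (hE : G.nodeGp n₀ = ((Subgroup.zpowers ε).map ι).topologicalClosure) :
    G.VerticialEdgeLikeCommensurablyTerminal :=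
  (G.twoComponentAffine_freeFactor_rows hne hprime ι hι hs hsr e hC v₀ v₁ hV ε hε hV₀ hV₁ n₀ hN hE).1

/-- **F-0440 / [CombGC] Prop. 1.5 (i) at every two-component affine datum**: an edge-like subgroup is
cuspidal iff it lies in exactly one verticial subgroup, non-cuspidal (the node) iff in exactly two — NOT
vacuous here: `Π_ν` lies in `Π_{v₀}` and `Π_{v₁}`, which are proper and distinct.
[cite: MochizukiCombGC2007, Prop 1.5(i) p.12] -/
theorem edgeLikeIncidence_of_twoComponentAffine (hne : Sigma.Nonempty)
    (hprime : ∀ p ∈ Sigma, p.Prime) (ι : PuncturedSurfaceGroup g r →* P)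
    (hι : IsProSigmaCompletion Sigma ι) (G : PSCDatum P) {g₀ s : ℕ} (hs : 2 ≤ s) (hsr : s + 2 ≤ r)
    (e : G.graph.C ≃ Fin r)
    (hC : ∀ c, G.cuspGp c =
      ((PuncturedSurfaceGroup.cuspInertia (g := g) (e c)).map ι).topologicalClosure)
    (v₀ v₁ : G.graph.V) (hV : ∀ w, w = v₀ ∨ w = v₁) (ε : PuncturedSurfaceGroup g r)
    (hε : ε = ((List.finRange r).map fun j : Fin r =>
          if s ≤ (j : ℕ) then PuncturedSurfaceGroup.c (g := g) j else 1).prod *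
        ((List.finRange g).map fun i : Fin g => if (i : ℕ) < g₀ then
          PuncturedSurfaceGroup.a (r := r) i * PuncturedSurfaceGroup.b i *
            (PuncturedSurfaceGroup.a i)⁻¹ * (PuncturedSurfaceGroup.b i)⁻¹ else 1).prod)
    (hV₀ : G.vertGp v₀ = ((Subgroup.closure {x : PuncturedSurfaceGroup g r |
        (∃ i : Fin g, (i : ℕ) < g₀ ∧ (x = PuncturedSurfaceGroup.a i ∨ x = PuncturedSurfaceGroup.b i)) ∨
        ∃ j : Fin r, s ≤ (j : ℕ) ∧ x = PuncturedSurfaceGroup.c j}).map ι).topologicalClosure)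
    (hV₁ : G.vertGp v₁ = ((Subgroup.closure {x : PuncturedSurfaceGroup g r |
        (∃ i : Fin g, g₀ ≤ (i : ℕ) ∧ (x = PuncturedSurfaceGroup.a i ∨ x = PuncturedSurfaceGroup.b i)) ∨
        (∃ j : Fin r, (j : ℕ) < s ∧ x = PuncturedSurfaceGroup.c j) ∨ x = ε}).map ι).topologicalClosure)
    (n₀ : G.graph.N) (hN : ∀ n, n = n₀)
    (hE : G.nodeGp n₀ = ((Subgroup.zpowers ε).map ι).topologicalClosure) : G.EdgeLikeIncidence :=
  (G.twoComponentAffine_freeFactor_rows hne hprime ι hι hs hsr e hC v₀ v₁ hV ε hε hV₀ hV₁ n₀ hN hE).2.1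

/-- **The distinct-branch-overgroups link at every two-component affine datum** whose semi-graph records the
node's two end vertices (`nodeEnds n = s(v₀, v₁)`): the two branch inclusions `Π_ν ≤ Π_{v₀}`, `Π_ν ≤ Π_{v₁}`
(trivial conjugators) land in DISTINCT verticial subgroups — the input of abc-iut-w4-d081's reduction of
[CombGC] Prop. 1.5 (ii) (`graphicIffEdgeLikeVerticial_of_incidence`). [cite: MochizukiCombGC2007, Prop 1.5(ii) p.13] -/
theorem branchLink_of_twoComponentAffine (hne : Sigma.Nonempty)
    (hprime : ∀ p ∈ Sigma, p.Prime) (ι : PuncturedSurfaceGroup g r →* P)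
    (hι : IsProSigmaCompletion Sigma ι) (G : PSCDatum P) {g₀ s : ℕ} (hs : 2 ≤ s) (hsr : s + 2 ≤ r)
    (e : G.graph.C ≃ Fin r)
    (hC : ∀ c, G.cuspGp c =
      ((PuncturedSurfaceGroup.cuspInertia (g := g) (e c)).map ι).topologicalClosure)
    (v₀ v₁ : G.graph.V) (hV : ∀ w, w = v₀ ∨ w = v₁) (ε : PuncturedSurfaceGroup g r)
    (hε : ε = ((List.finRange r).map fun j : Fin r =>
          if s ≤ (j : ℕ) then PuncturedSurfaceGroup.c (g := g) j else 1).prod *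
        ((List.finRange g).map fun i : Fin g => if (i : ℕ) < g₀ then
          PuncturedSurfaceGroup.a (r := r) i * PuncturedSurfaceGroup.b i *
            (PuncturedSurfaceGroup.a i)⁻¹ * (PuncturedSurfaceGroup.b i)⁻¹ else 1).prod)
    (hV₀ : G.vertGp v₀ = ((Subgroup.closure {x : PuncturedSurfaceGroup g r |
        (∃ i : Fin g, (i : ℕ) < g₀ ∧ (x = PuncturedSurfaceGroup.a i ∨ x = PuncturedSurfaceGroup.b i)) ∨
        ∃ j : Fin r, s ≤ (j : ℕ) ∧ x = PuncturedSurfaceGroup.c j}).map ι).topologicalClosure)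
    (hV₁ : G.vertGp v₁ = ((Subgroup.closure {x : PuncturedSurfaceGroup g r |
        (∃ i : Fin g, g₀ ≤ (i : ℕ) ∧ (x = PuncturedSurfaceGroup.a i ∨ x = PuncturedSurfaceGroup.b i)) ∨
        (∃ j : Fin r, (j : ℕ) < s ∧ x = PuncturedSurfaceGroup.c j) ∨ x = ε}).map ι).topologicalClosure)
    (n₀ : G.graph.N) (hN : ∀ n, n = n₀)
    (hE : G.nodeGp n₀ = ((Subgroup.zpowers ε).map ι).topologicalClosure)
    (hends : ∀ n, G.graph.nodeEnds n = s(v₀, v₁)) :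
    ∀ n : G.graph.N, ∃ (w₁ w₂ : G.graph.V) (γ₁ γ₂ : ConjAct P),
      G.graph.nodeEnds n = s(w₁, w₂) ∧ γ₁ • G.nodeGp n ≤ G.vertGp w₁ ∧
        γ₂ • G.nodeGp n ≤ G.vertGp w₂ ∧ γ₁⁻¹ • G.vertGp w₁ ≠ γ₂⁻¹ • G.vertGp w₂ := by
  obtain ⟨-, -, hinf, hvne⟩ :=
    G.twoComponentAffine_freeFactor_rows hne hprime ι hι hs hsr e hC v₀ v₁ hV ε hε hV₀ hV₁ n₀ hN hE
  intro n
  refine ⟨v₀, v₁, 1, 1, hends n, ?_, ?_, ?_⟩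
  · rw [one_smul, hN n, ← hinf]; exact inf_le_left
  · rw [one_smul, hN n, ← hinf]; exact inf_le_right
  · rwa [inv_one, one_smul, one_smul]

end PSCDatum

end Literature.AnabelianGeometry.SemiGraphs

end
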